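import Mathlib.Algebra.Order.BigOperators.Ring.Finset
import Mathlib.Algebra.BigOperators.Ring.Finset
import Mathlib.Data.Fintype.BigOperators
import Mathlib.Data.Real.Basic
import Mathlib.Tactic.Ring
import HarnessLib

/-!
# Route `SymplecticPurity`, item `DeqThesis` (stmt-QuantumAdvantage-0242), line `Sketch` — product weights

Four combinatorial identities about the PRODUCT WEIGHTS `w t = ∏ j, (if t j then s j else c j)` on
the Boolean cube `Fin m → Bool` (the modulus pattern of the matrix elements of a tensor product of
single-qubit real reflections `c j • Z + s j • X` along a bit-flip pattern `t`), consumed by the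
real-tilt analysis of the core stub of the line:

* `sum_abs_productWeight` — ℓ¹ mass `Σ_t |w t| = ∏ j (|c j| + |s j|)`;
* `sum_sq_productWeight` — ℓ² mass `Σ_t (w t)² = ∏ j (c j ^ 2 + s j ^ 2)`;
* `productWeight_eq_walsh_sum` — Walsh–Fourier inversion `w t = 2⁻ᵐ Σ_b ŵ b · (−1)^{b · t}` with
  `ŵ b = ∏ j (c j + (−1)^{b j} s j)`;
* `sum_abs_walshProductWeight` — Fourier ℓ¹ mass `Σ_b |ŵ b| = ∏ j (|c j + s j| + |c j − s j|)`;
* `stub_productWeightFourier` — the registered conjunction of the four.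

All four are instances of multilinearity on the cube (`sum_cube_prod_ite`, from `Fintype.prod_sum`):
`Σ_{t : Fin m → Bool} ∏ j (if t j then y j else x j) = ∏ j (x j + y j)`.
-/

set_option linter.dupNamespace false -- D-0017: single-problem summit ⇒ `QuantumAdvantage.QuantumAdvantage` by design

namespace Summit.QuantumAdvantage.QuantumAdvantage.Theorems.SymplecticPurity

open Finset

/-- Multilinearity on the Boolean cube: expanding `∏ j (x j + y j)` chooses, at every site `j`,
either `x j` (`t j = false`) or `y j` (`t j = true`). -/
theorem sum_cube_prod_ite (m : ℕ) (x y : Fin m → ℝ) :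
    ∑ t : Fin m → Bool, ∏ j, (if t j then y j else x j) = ∏ j, (x j + y j) :=
  calc ∑ t : Fin m → Bool, ∏ j, (if t j then y j else x j)
      = ∏ j, ∑ b : Bool, (if b then y j else x j) :=
        (Fintype.prod_sum fun (j : Fin m) (b : Bool) => if b then y j else x j).symm
    _ = ∏ j, (x j + y j) := by
        refine Finset.prod_congr rfl (fun j _ => ?_)
        rw [Fintype.sum_bool, add_comm]
        simp

/-- ℓ¹ mass of the product weights: `Σ_t |∏ j (if t j then s j else c j)| = ∏ j (|c j| + |s j|)`. -/
theorem sum_abs_productWeight (m : ℕ) (c s : Fin m → ℝ) :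
    ∑ t : Fin m → Bool, |∏ j, (if t j then s j else c j)| = ∏ j, (|c j| + |s j|) := by
  rw [← sum_cube_prod_ite]
  refine Finset.sum_congr rfl (fun t _ => ?_)
  rw [Finset.abs_prod]
  refine Finset.prod_congr rfl (fun j _ => ?_)
  split_ifs <;> rfl

/-- ℓ² mass of the product weights: `Σ_t (∏ j (if t j then s j else c j))² = ∏ j (c j² + s j²)`. -/
theorem sum_sq_productWeight (m : ℕ) (c s : Fin m → ℝ) :
    ∑ t : Fin m → Bool, (∏ j, (if t j then s j else c j)) ^ 2 = ∏ j, (c j ^ 2 + s j ^ 2) := by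
  rw [← sum_cube_prod_ite]
  refine Finset.sum_congr rfl (fun t _ => ?_)
  rw [← Finset.prod_pow]
  refine Finset.prod_congr rfl (fun j _ => ?_)
  split_ifs <;> rfl

/-- Walsh–Fourier inversion for the product weights: with `ŵ b = ∏ j (c j + (−1)^{b j} s j)`,
`∏ j (if t j then s j else c j) = 2⁻ᵐ Σ_b ŵ b · ∏ j (−1)^{b j ∧ t j}`.  Site by site this is
`(if t then s else c) = ½ ((c + s) + (c − s) · (−1)^t)`. -/
theorem productWeight_eq_walsh_sum (m : ℕ) (c s : Fin m → ℝ) (t : Fin m → Bool) :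
    (∏ j, (if t j then s j else c j)) =
      (2 : ℝ)⁻¹ ^ m * ∑ b : Fin m → Bool,
        (∏ j, (c j + (if b j then -(s j) else s j))) *
          ∏ j, (if (b j && t j) then (-1 : ℝ) else 1) := by
  have hsum : ∑ b : Fin m → Bool, (∏ j, (c j + (if b j then -(s j) else s j))) *
      ∏ j, (if (b j && t j) then (-1 : ℝ) else 1) =
        ∏ j, ((c j + s j) + (c j - s j) * (if t j then (-1 : ℝ) else 1)) := by
    rw [← sum_cube_prod_ite]
    refine Finset.sum_congr rfl (fun b _ => ?_)
    rw [← Finset.prod_mul_distrib]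
    refine Finset.prod_congr rfl (fun j _ => ?_)
    cases b j <;> simp [sub_eq_add_neg]
  rw [hsum]
  calc ∏ j, (if t j then s j else c j)
      = ∏ j, ((2 : ℝ)⁻¹ * ((c j + s j) + (c j - s j) * (if t j then (-1 : ℝ) else 1))) := by
        refine Finset.prod_congr rfl (fun j _ => ?_)
        cases t j <;> simp <;> ring
    _ = (2 : ℝ)⁻¹ ^ m * ∏ j, ((c j + s j) + (c j - s j) * (if t j then (-1 : ℝ) else 1)) := by
        rw [Finset.prod_mul_distrib, Finset.prod_const, Finset.card_univ, Fintype.card_fin]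

/-- Fourier ℓ¹ mass of the product weights:
`Σ_b |∏ j (c j + (−1)^{b j} s j)| = ∏ j (|c j + s j| + |c j − s j|)`. -/
theorem sum_abs_walshProductWeight (m : ℕ) (c s : Fin m → ℝ) :
    ∑ b : Fin m → Bool, |∏ j, (c j + (if b j then -(s j) else s j))| =
      ∏ j, (|c j + s j| + |c j - s j|) := by
  rw [← sum_cube_prod_ite]
  refine Finset.sum_congr rfl (fun b _ => ?_)
  rw [Finset.abs_prod]
  refine Finset.prod_congr rfl (fun j _ => ?_)
  cases b j <;> simp [sub_eq_add_neg]

/-- SG1 of line `Sketch` (crux `DeqThesis`): the combinatorics of product weights on the cube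
`Fin m → Bool` — ℓ¹ mass, ℓ² mass, Walsh–Fourier inversion, and Fourier ℓ¹ mass. -/
theorem stub_productWeightFourier : ∀ (m : ℕ) (c s : Fin m → ℝ),
    (∑ t : Fin m → Bool, |∏ j, (if t j then s j else c j)| = ∏ j, (|c j| + |s j|)) ∧
    (∑ t : Fin m → Bool, (∏ j, (if t j then s j else c j)) ^ 2 = ∏ j, (c j ^ 2 + s j ^ 2)) ∧
    (∀ t : Fin m → Bool, (∏ j, (if t j then s j else c j)) =
      (2 : ℝ)⁻¹ ^ m * ∑ b : Fin m → Bool,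
        (∏ j, (c j + (if b j then -(s j) else s j))) * ∏ j, (if (b j && t j) then (-1 : ℝ) else 1)) ∧
    (∑ b : Fin m → Bool, |∏ j, (c j + (if b j then -(s j) else s j))| =
      ∏ j, (|c j + s j| + |c j - s j|)) := by
  intro m c s
  exact ⟨sum_abs_productWeight m c s, sum_sq_productWeight m c s,
    productWeight_eq_walsh_sum m c s, sum_abs_walshProductWeight m c s⟩

end Summit.QuantumAdvantage.QuantumAdvantage.Theorems.SymplecticPurity
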